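import Literature.MathematicalPhysics.QuantumLattice.HubbardModel
import HarnessLib

/-!
# The Lieb–Schultz–Mattis–Oshikawa filling constraint for the Hubbard model on tori, after
# Bachmann–Bols–De Roeck–Fraas (named fact)

Trunk T-QLATTICE, family `hubbard`. Bachmann, Bols, De Roeck and Fraas, *A many-body index for
quantum charge transport*, Comm. Math. Phys. 375 (2019) 1249–1272 (arXiv:1810.07351), prove an
index theorem (their Theorem 2.1) for a unitary `U` and a state `Ω` on the discrete `d`-torus
`Λ_L = ℤ_L^d` (`L` even, §2.1.1), for spin systems AND lattice fermions (§2.1.3: the observable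
algebra is the even CAR algebra; "in the case of fermions, the 'interaction' `Φ` also contains the
hopping terms", §2.4), under Assumptions (i)–(v) of §2.2: (i) `U` almost local, (ii) local charge
conservation `U⋆QU - Q = T₋ + T₊ + O(L^{-∞})`, (iii) `Ω` an approximate eigenvector of `U`,
(iv) local charge fluctuations of `Ω`, (v) exponential clustering of `Ω` in the `x₁`-direction;
here `Q_x ∈ 𝒜_{x}` are local charges with `Spec(Q_x) ⊆ ℤ` and `Q = Q_Γ`, `Γ` the half-torus.
**Theorem 2.1**: `⟨Ω, T₋ Ω⟩ ∈ ℤ_{(O(L^{-∞}))}`. **Proposition 2.4**: for `H = Σ_X Φ_X` of finite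
range `R`, finite interaction strength `‖Φ_X‖ ≤ m`, charge conserving (`[Φ_X, Q_Y] = 0` for
`X ⊆ Y`), with `Ω` its non-degenerate gapped (gap `g`) ground state and `R, m, g` independent of
`L`, Assumptions (iv), (v) hold. **Example 2 / §3.2 (Lieb–Schultz–Mattis)**: for `U` the
translation `x₁ ↦ x₁ + 1` and a translation-invariant `H` with non-degenerate gapped ground state
`Ω` (an eigenvector of `U`), `T₋ = -Q_{[0]}`, `T₊ = Q_{[L/2]}` satisfy (ii) and the constraint
(2.7) exactly, and Theorem 2.1 gives
`⟨Ω, Q_{[0]} Ω⟩ = L⁻¹ ⟨Ω, Q_Λ Ω⟩ ∈ ℤ_{(O(L^{-∞}))}` — "if `Ω` is clustering – as is the case for a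
unique gapped ground state – then the average charge per transverse layer is an integer"
(§1.2, Example 2), the torus form of Oshikawa's commensurability condition ("a finite excitation
gap is possible only if the particle number per unit cell of the ground state is an integer",
Oshikawa 2000, p. 1; there a fixed-`N` flux-insertion argument, "not yet mathematically rigorous
for the thermodynamic limit", p. 3).

## What is vendored (`bbdf2019_lsm_filling_hubbardTorus`, a named fact) and how BBDF's
## hypotheses are discharged for the Hubbard tori of the summit

The instance of Theorem 2.1 + Proposition 2.4 + §3.2 for the (grand-canonical) Hubbard
Hamiltonian `hubbardTorusWith d L t U μ = -t Σ_{⟨xy⟩,σ} c†_{xσ}c_{yσ} + U Σ_x n_{x↑}n_{x↓} - μN`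
(`Literature.MathematicalPhysics.QuantumLattice.HubbardModel`) on the fermionic torus
`FermionTorus d L ≅ ℤ_L^d`, acting on the full Fock space `Fock (Orb (FermionTorus d L))`, with
the TWO conserved charges `Q^σ_x = n_{xσ}`, `σ ∈ {↑, ↓}`:
* spatial setup (§2.1.1): `ℤ_L^d`, `L` even — hypothesis `Even (L j) ∧ 2 ≤ L j`; `d ≥ 1` so that
  the `x₁`-translation exists;
* charges: `n_{xσ} ∈ 𝒜_{x}` is even with spectrum `{0, 1} ⊆ ℤ`; every term of `H` (hopping
  `c†_{xσ}c_{yσ}`, `n_{x↑}n_{x↓}`, `-μ n_{xσ}`) is even and conserves `Q^σ_Y` for `Y ⊇` its support,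
  so BBDF's charge conservation holds for each `σ` separately; range `R = 1`, strength
  `m = m(t, U, μ)` — independent of `L`;
* (i), (ii): `U` = translation by `e₁` is strictly local (`U⋆𝒜_X U = 𝒜_{X+e₁} ⊆ 𝒜_{X¹}`) and
  `U⋆ Q_Γ U - Q_Γ = -Q_{[0]} + Q_{[L/2]}` exactly (§3.2);
* (iii): `H` is translation invariant and its ground state is assumed NON-DEGENERATE, hence an
  eigenvector of `U`, so `Var_Ω(U) = 0`;
* (iv), (v): Proposition 2.4 from the hypothesis `HasSpectralGap (hubbardTorusWith …) g` — ground
  energy a simple eigenvalue, all other eigenvalues `≥ E₀ + g` — with ONE `g > 0` along the whole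
  sequence of sides (BBDF §2.1.5: "bounds hold for all `L` with constants uniform in `L`").
Conclusion, in the `O(L^{-∞})` form of Theorem 2.1: for every `k` there is `C` (depending on
`d, t, U, μ, g, k` and the sequence) such that for every side `L_j` of the sequence the unique ground
state — which is a joint eigenvector of `N_↑ = N/2 + S^z` and `N_↓ = N/2 - S^z`, i.e. lies in some
`szSector N M` — has `N_σ / L_j` within `C L_j^{-k}` of an integer for both `σ` (by translation
invariance `⟨Ω, Q^σ_{[0]} Ω⟩ = N_σ / L`). `N / L_j` is then within `2C L_j^{-k}` of an integer
(`bbdf2019_lsm_filling_hubbardTorus.total`). In `d = 2` this says: the filling per spin and column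
`N_σ/L` of a translation-symmetric unique uniformly-gapped ground-state sequence is
super-polynomially close to `ℤ`; read contrapositively at fractional column fillings it forbids such
sequences (the use made of it by route `HubbardSuperconductivity/AnomalyExhaustion`, hypothesis
`EtsTrichotomy`, where it is a justification and not a premise).

Deliberately NOT here: BBDF's general theorem (no framework for general finite-range even
interactions on the CAR algebra of a torus in the tree), the fixed-`N` sector version (Oshikawa's
flux insertion at fixed particle number is not covered by BBDF's Proposition 2.4, whose gap is
the gap of `H` on the whole Hilbert space; a sector ground state enters only when it is the global
ground state of `H - μN` for some `μ`, which is exactly the form below), the `SU(2)`/half-odd-spin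
LSM theorem (Hastings 2004, Nachtergaele–Sims 2007), and any degeneracy count (`q`-fold, Oshikawa).

## References

* S. Bachmann, A. Bols, W. De Roeck, M. Fraas, Comm. Math. Phys. 375 (2019) 1249, arXiv:1810.07351:
  §2.1.1 (torus, `L` even), §2.1.3 (fermions, even algebra), §2.2 Assumptions (i)–(v) and
  Theorem 2.1, §2.4 Proposition 2.4 (unique gapped ground state ⇒ (iv),(v)), §1.2 Example 2 and
  §3.2 (Lieb–Schultz–Mattis: `⟨Ω, Q_{[0]} Ω⟩ ∈ ℤ_{(O(L^{-∞}))}`).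
* M. Oshikawa, Phys. Rev. Lett. 84 (2000) 1535 (commensurability condition, flux insertion).
* M. B. Hastings, Phys. Rev. B 69 (2004) 104431; B. Nachtergaele, R. Sims, Comm. Math. Phys. 276
  (2007) 437 (multi-dimensional LSM; clustering of gapped ground states).
-/

noncomputable section

namespace Literature.MathematicalPhysics.QuantumLattice

open Matrix Finset HubbardWave0 Literature.Probability.LatticeModels
open scoped ComplexOrder

/-- **BBDF 2019 — Lieb–Schultz–Mattis–Oshikawa filling constraint for the Hubbard model on tori
(named fact).** Instance of Bachmann–Bols–De Roeck–Fraas, Theorem 2.1 with Proposition 2.4 and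
§3.2 (Example 2), for the charge-conserving, translation-invariant, range-`1` fermionic
Hamiltonian `hubbardTorusWith d L t U μ` on the even torus `ℤ_L^d` and the conserved integer
charges `n_{x↑}`, `n_{x↓}`: if along a sequence of even sides `L_j ≥ 2` the Hamiltonian has a
unique ground state with a uniform spectral gap `g > 0` on the whole Fock space
(`Matrix.HasSpectralGap`), then for every `k` there is `C` such that, for every `j`, the ground
state (a vector of some joint sector `szSector N M`, `N_↑ = N/2 + M`, `N_↓ = N/2 - M`) has both
`N_↑ / L_j` and `N_↓ / L_j` within `C · L_j^{-k}` of an integer ("the average charge per transverse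
layer is an integer" up to `O(L^{-∞})`, `⟨Ω, Q_{[0]} Ω⟩ = N_σ/L ∈ ℤ_{(O(L^{-∞}))}`). How each of
BBDF's Assumptions (i)–(v) is met is recorded in the module docstring. Users take
`(h : bbdf2019_lsm_filling_hubbardTorus)`.
[cite: BachmannEtAl2019, Thm 2.1 with Prop 2.4 and §3.2 (Example 2)] -/
def bbdf2019_lsm_filling_hubbardTorus : Prop :=
  ∀ (d : ℕ) (t U μ g : ℝ) (L : ℕ → ℕ), 1 ≤ d → 0 < g → (∀ j, Even (L j) ∧ 2 ≤ L j) →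
    (∀ j, (hubbardTorusWith d (L j) t U μ).HasSpectralGap g) →
    ∀ k : ℕ, ∃ C : ℝ, ∀ (j : ℕ) (N : ℕ) (M : ℝ) (ψ : Fock (Orb (FermionTorus d (L j)))),
      (hubbardTorusWith d (L j) t U μ).IsGroundStateVector ψ → ψ ∈ szSector N M →
        (∃ n : ℤ, |((N : ℝ) / 2 + M) / L j - n| ≤ C / (L j : ℝ) ^ k) ∧
        (∃ n : ℤ, |((N : ℝ) / 2 - M) / L j - n| ≤ C / (L j : ℝ) ^ k)

/-- **The total-charge form** (BBDF §3.2 with `Q_x = n_{x↑} + n_{x↓}`): under the hypotheses of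
`bbdf2019_lsm_filling_hubbardTorus`, the particle number `N` of the unique ground state at side
`L_j` has `N / L_j` within `2C · L_j^{-k}` of an integer (sum of the two spin-resolved statements).
[cite: BachmannEtAl2019, §3.2 (Example 2)] -/
theorem bbdf2019_lsm_filling_hubbardTorus.total (h : bbdf2019_lsm_filling_hubbardTorus)
    (d : ℕ) (t U μ g : ℝ) (L : ℕ → ℕ) (hd : 1 ≤ d) (hg : 0 < g)
    (hL : ∀ j, Even (L j) ∧ 2 ≤ L j) (hgap : ∀ j, (hubbardTorusWith d (L j) t U μ).HasSpectralGap g)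
    (k : ℕ) :
    ∃ C : ℝ, ∀ (j : ℕ) (N : ℕ) (M : ℝ) (ψ : Fock (Orb (FermionTorus d (L j)))),
      (hubbardTorusWith d (L j) t U μ).IsGroundStateVector ψ → ψ ∈ szSector N M →
        ∃ n : ℤ, |(N : ℝ) / L j - n| ≤ 2 * C / (L j : ℝ) ^ k := by
  obtain ⟨C, hC⟩ := h d t U μ g L hd hg hL hgap k
  refine ⟨C, fun j N M ψ hψ hmem ↦ ?_⟩
  obtain ⟨⟨n₁, h₁⟩, ⟨n₂, h₂⟩⟩ := hC j N M ψ hψ hmem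
  refine ⟨n₁ + n₂, ?_⟩
  have hsum : (N : ℝ) / L j - ((n₁ + n₂ : ℤ) : ℝ) =
      (((N : ℝ) / 2 + M) / L j - n₁) + (((N : ℝ) / 2 - M) / L j - n₂) := by
    push_cast
    ring
  rw [hsum]
  calc |(((N : ℝ) / 2 + M) / L j - n₁) + (((N : ℝ) / 2 - M) / L j - n₂)|
      ≤ |((N : ℝ) / 2 + M) / L j - n₁| + |((N : ℝ) / 2 - M) / L j - n₂| := abs_add_le _ _
    _ ≤ C / (L j : ℝ) ^ k + C / (L j : ℝ) ^ k := add_le_add h₁ h₂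
    _ = 2 * C / (L j : ℝ) ^ k := by ring

/-- **Contrapositive use at a fractional column filling** (how route `AnomalyExhaustion` reads the
constraint): if along the sequence the ground states lie in sectors `szSector (N j) (M j)` whose
up-spin column filling `(N j / 2 + M j) / L j` stays at distance `≥ ε > 0` from `ℤ` while
`L_j → ∞`, then no uniform gap `g > 0` with unique ground states is possible. Immediate from the
`k = 1` case. [cite: BachmannEtAl2019, §1.2 (Example 2) and §3.2] -/
theorem bbdf2019_lsm_filling_hubbardTorus.not_hasSpectralGap
    (h : bbdf2019_lsm_filling_hubbardTorus) (d : ℕ) (t U μ g ε : ℝ) (L N : ℕ → ℕ) (M : ℕ → ℝ)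
    (ψ : ∀ j, Fock (Orb (FermionTorus d (L j)))) (hd : 1 ≤ d) (hg : 0 < g) (hε : 0 < ε)
    (hL : ∀ j, Even (L j) ∧ 2 ≤ L j) (hLtop : Filter.Tendsto (fun j ↦ (L j : ℝ)) Filter.atTop Filter.atTop)
    (hψ : ∀ j, (hubbardTorusWith d (L j) t U μ).IsGroundStateVector (ψ j))
    (hmem : ∀ j, ψ j ∈ szSector (N j) (M j))
    (hfrac : ∀ j (n : ℤ), ε ≤ |((N j : ℝ) / 2 + M j) / L j - n|) :
    ¬ ∀ j, (hubbardTorusWith d (L j) t U μ).HasSpectralGap g := by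
  intro hgap
  obtain ⟨C, hC⟩ := h d t U μ g L hd hg hL hgap 1
  -- choose `j` with `L j > C / ε`
  obtain ⟨j, hj⟩ := (Filter.tendsto_atTop.1 hLtop (C / ε + 1)).exists
  obtain ⟨⟨n, hn⟩, -⟩ := hC j (N j) (M j) (ψ j) (hψ j) (hmem j)
  have hLpos : (0 : ℝ) < L j := by
    have := (hL j).2
    exact_mod_cast (show 0 < L j by omega)
  have h1 : ε ≤ C / (L j : ℝ) ^ 1 := (hfrac j n).trans hn
  rw [pow_one, le_div_iff₀ hLpos] at h1
  have h2 : C / ε + 1 ≤ (L j : ℝ) := hj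
  have h3 : C < ε * (L j : ℝ) := by
    have : C / ε < L j := by linarith
    rwa [div_lt_iff₀ hε, mul_comm] at this
  linarith

end Literature.MathematicalPhysics.QuantumLattice

end
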